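import Summits.QuantumFields.YangMills.Theorems.BalabanUVNodesN15SiteColouredWords
import Summits.QuantumFields.YangMills.Theorems.BalabanUVNodesN15VectorPieceBackgroundMatrix
import HarnessLib

/-!
# Route «BalabanUVNodes», cluster K4 «SpineRates» — node N15 = NE2: THE SITE LAYER WITH THE BACKGROUND LIVE IN THE TwoGrid ENTRY CURRENCY, XXIII — THE COLOURED MASSLESS SITE LAYER
# `G′ ⊗ 1_ι` DRESSED BY A COLOUR-MIXING MATRIX SPECIES: the coloured socket's three letters and `NE2PlusSite` (every colour entry, size live) from a matrix species' three diagonal letters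
# read at size — parts VII∕VIII lifted by `⊗ 1_ι` (`hasMaj_tensorId`), dag-n15-c S4's dressing on the coloured carrier, part XXII's words, part XXI's socket

Cell `pub-ymgap`, WIDTH SEAT `pub-ymgap-dag-n15-w1` (generation 3; director-ym №197 ∕ HUMAN RULING D-0149; chair R455 (A) ∕ R461; plan g83 `W-SEAT-START-LIST.md` v11 §n15; (α) step 3 of 4).
`bears_on: R4∕N15 · K3⁷ SpineGivenEndpointR13SepCoPH (stmt-QuantumFields-20544)`.  Filed `--kind proof --supports stmt-QuantumFields-20544 --as helper` — COUNT-NEUTRAL.  THEOREMS ONLY (0 `def`,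
0 `sorry`).  Imports BY NAME this seat's part XXII `…N15SiteColouredWords` (through it part XXI, part XI, parts VII∕VIII `kingScalarLayer_massless_letters`, dag-n15-c S4 `hasMaj_dressedOp` ∕
`_sub` ∕ `hasMaj_idef_dressedOp`, `bgConst`) and dag-n15-c's `…N15VectorPieceBackgroundMatrix` (`tensorId`, `hasMaj_tensorId`, `idef_tensorId`); nothing in the tree is modified.

WHY.  Parts IX∕XI dressed THE massless scalar site propagator `G′` by a SCALAR species.  Bałaban's scalar fields are `R(U)`-valued ([Balaban1985BackgroundPropagators] (3.1)–(3.5)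
p.390) and the first-order perturbation (3.52) acts through `R′(A)` — in coordinates `e : 𝔄 ≃ ℝ^ι` a MATRIX coefficient on the colour index, mixing colours.  THIS FILE is part XI §2∕§3
on the coloured carriers `Tor(fine) × ι`: the `U ≡ 1` layer is `G′ ⊗ 1_ι`, `D_μ ⊗ 1_ι` (letters = the scalar letters, `hasMaj_tensorId`; two-grid defects commute with the lift,
`idef_tensorId`), the species is ANY `V̂ : ((X × ι) × Option (Fin (d+1)) → ℝ) →ₗ (X × ι → ℝ)` with three diagonal letters AT SIZE in n15-b's matrix frames (`blkPair (liftBlk blockOf ι)`),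
S4's three dressing theorems run on the block map `liftBlk blockOf ι`, part XXII §3 turns the dressed block letters into part XXI's three coloured-entry letters, and part XXI's socket
gives `NE2PlusSite` for every colour entry — size LIVE.  The concrete `ad A′` species of FILE 40's family is the sequel (step 4).

CONTENTS.  §1 `tensorId_massless_letters` (parts VII∕VIII lifted: the six `U ≡ 1` letters of `G′ ⊗ 1`, `D_μ ⊗ 1` at both spacings and their two-grid defects); §2 ★★★
`siteLettersC_of_sizedSpeciesLettersM` (part XI §2 on the coloured carrier); §3 ★★★ `ne2PlusSite_cSiteExOn_of_sizedSpeciesLettersM` (part XXI's socket ∘ §2).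

HONEST FRAMING.  Count-neutral, species-independent BRIDGE; no new estimate; the species is a BINDER here.  The `U ≡ 1` coloured layer `G′ ⊗ 1_ι` is genuine; what a kernel reads is ONE
colour entry of the dressed inverse (the tree's `B9.SiteKernel` is scalar-valued), uniformly over entries.  The averaging perturbation `F₂` is dropped on this road (as parts IX∕XI).  NOT
[B9] Thm 3.2 at a general (3.35)-regular `U` (NE2⁺ NOT PRINTED as an η-rate); Node 00's [B9] layers of record are residual — **N15 is NOT discharged** (typed 28∕28 · discharged 5∕27 of
record unchanged); K3⁷ OPEN, its N15 pin untouched; one finite four-torus programme at fixed `ε` — NOT ℝ⁴, NOT infinite volume, NOT OS, NOT a mass gap, NOT Clay; R4 closes the conditional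
finite-𝕋⁴ rung `BalabanLadder.UV` only.  Restate-immune.
-/

set_option autoImplicit false

noncomputable section

open scoped BigOperators Matrix
open Finset

namespace Summit.QuantumFields.YangMills.BalabanUVNodes.N15.SiteLayerBg

open Literature.MathematicalPhysics.QuantumFieldTheory.Balaban1983to89
open Literature.MathematicalPhysics.QuantumFieldTheory.Balaban1983to89.B11SectG (BlockNorm HasMaj RowSum)
open Literature.MathematicalPhysics.QuantumFieldTheory.Balaban1983to89.T4EtaRate (PairedInstance EtaPairing NE2PlusSite)
open Literature.MathematicalPhysics.QuantumFieldTheory.Balaban1983to89.T4EtaRateDefect (idef)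
open Literature.MathematicalPhysics.QuantumFieldTheory.Balaban1983to89.T4EtaRateCoeffDefect (pull diagK diagK_nonneg diagK_mono fibre)
open Literature.MathematicalPhysics.QuantumFieldTheory.Balaban1983to89.B5Prop11Plancherel (Tor fine)
open Literature.MathematicalPhysics.QuantumFieldTheory.Balaban1983to89.B4Sect5Torus (tdist)
open Literature.MathematicalPhysics.QuantumFieldTheory.Balaban1983to89.B4Sect5Proof (latticeConst latticeConst_nonneg)
open Literature.MathematicalPhysics.QuantumFieldTheory.Balaban1983to89.B5QGGQ145Bounds (Idx)
open Literature.MathematicalPhysics.QuantumFieldTheory.Balaban1983to89.B6UnitTorusCarrier (unitTorusGeo triangle254_unitTorusGeo rowSum_unitTorusGeo)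
open Literature.MathematicalPhysics.QuantumFieldTheory.Balaban1983to89.B9SectDSup (inv_one_sub_le_two)
open Literature.MathematicalPhysics.QuantumFieldTheory.King1986 (aK aK_pos)
open Literature.MathematicalPhysics.QuantumFieldTheory.King1986.Torus (fineOp blockOf tdistT tdistT_nonneg)
open Summit.QuantumFields.YangMills.BalabanUVNodes.N15.VectorPiece (unitTorusGeoS unitTorusGeoS_dist tensorId hasMaj_tensorId idef_tensorId)
open Summit.QuantumFields.YangMills.BalabanUVNodes.N15.MatrixSpecies (liftMap liftBlk)
open Summit.QuantumFields.YangMills.BalabanUVNodes.N15.OperatorReadout (opGeo)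
open Summit.QuantumFields.YangMills.BalabanUVNodes.N15.BackgroundLayer (blkPair liftPair bgConst bgConst_nonneg)
open Summit.QuantumFields.YangMills.BalabanUVNodes.N15.SiteLayer (siteForm dressedOp hasMaj_dressedOp hasMaj_dressedOp_sub hasMaj_idef_dressedOp)
open Summit.QuantumFields.YangMills.BalabanUVNodes.N15KingModelRung.Curved (kingGOp kingDOp underPtN)

variable {d : ℕ} {L : ℕ} [NeZero L] {I : Type}

/-! ## §1 Parts VII∕VIII lifted to the coloured carriers: the six `U ≡ 1` letters of `G′ ⊗ 1_ι`, `D_μ ⊗ 1_ι` -/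

section Lifted

variable (ι : Type) [Fintype ι]

/-- **THE MASSLESS SCALAR SITE LAYER LIFTED BY `⊗ 1_ι`**: parts VII∕VIII's six letters (`kingScalarLayer_massless_letters`) for `G′ ⊗ 1_ι`, `D_μ ⊗ 1_ι` at both spacings — same constants,
blocks `liftBlk blockOf ι` ∕ `liftBlk (blockOf ∘ pr) ι`, two-grid defects through `(pull (liftMap pr ι), pull (liftMap pr ι))` (`hasMaj_tensorId`, `idef_tensorId`).
[cite: Balaban1984PropagatorsII, (2.156) p.250 (the U ≡ 1 propagator acts diagonally in colour: shape); King1986, Prop. 3.8 (3.71) p.664] -/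
theorem tensorId_massless_letters (hLodd : Odd L) (hL : 2 ≤ L) {a : ℝ} (ha : 0 < a) {γ : ℝ} (hγ0 : 0 ≤ γ) (hγ1 : γ < 1) :
    ∃ β δ m₀ : ℝ, 0 < β ∧ 0 < δ ∧ 0 < m₀ ∧ ∀ (K : ℕ), 1 ≤ K → ∀ (n : ℕ), 1 ≤ n → ∀ (e : ℕ) (M : Fin (d + 1) → ℕ) [∀ μ, NeZero (M μ)],
      (∀ μ, M μ = 2 * L ^ e) → ∀ (Msz : ℝ),
      HasMaj (BlockNorm.ofBlocks (unitTorusGeoS L K M Msz) (liftBlk (blockOf (L ^ K) M) ι)) (BlockNorm.ofBlocks (unitTorusGeoS L K M Msz) (liftBlk (blockOf (L ^ K) M) ι))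
          (tensorId ι (kingGOp L a 0 K (L ^ K) M)) (fun y y' => β * Real.exp (-(δ * tdistT M y y')))
      ∧ (∀ μ, HasMaj (BlockNorm.ofBlocks (unitTorusGeoS L K M Msz) (liftBlk (blockOf (L ^ K) M) ι)) (BlockNorm.ofBlocks (unitTorusGeoS L K M Msz) (liftBlk (blockOf (L ^ K) M) ι))
          (tensorId ι (kingDOp L a 0 K (L ^ K) M μ)) (fun y y' => β * Real.exp (-(δ * tdistT M y y'))))
      ∧ HasMaj (BlockNorm.ofBlocks (unitTorusGeoS L K M Msz) (liftBlk (blockOf (L ^ K) M ∘ underPtN L K n M) ι))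
          (BlockNorm.ofBlocks (unitTorusGeoS L K M Msz) (liftBlk (blockOf (L ^ K) M ∘ underPtN L K n M) ι))
          (tensorId ι (kingGOp L a 0 (K + n) (L ^ n * L ^ K) M)) (fun y y' => β * Real.exp (-(δ * tdistT M y y')))
      ∧ (∀ μ, HasMaj (BlockNorm.ofBlocks (unitTorusGeoS L K M Msz) (liftBlk (blockOf (L ^ K) M ∘ underPtN L K n M) ι))
          (BlockNorm.ofBlocks (unitTorusGeoS L K M Msz) (liftBlk (blockOf (L ^ K) M ∘ underPtN L K n M) ι))
          (tensorId ι (kingDOp L a 0 (K + n) (L ^ n * L ^ K) M μ)) (fun y y' => β * Real.exp (-(δ * tdistT M y y'))))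
      ∧ HasMaj (BlockNorm.ofBlocks (unitTorusGeoS L K M Msz) (liftBlk (blockOf (L ^ K) M) ι))
          (BlockNorm.ofBlocks (unitTorusGeoS L K M Msz) (liftBlk (blockOf (L ^ K) M ∘ underPtN L K n M) ι))
          (idef (pull (liftMap (underPtN L K n M) ι)) (pull (liftMap (underPtN L K n M) ι)) (tensorId ι (kingGOp L a 0 (K + n) (L ^ n * L ^ K) M)) (tensorId ι (kingGOp L a 0 K (L ^ K) M)))
          (fun y y' => m₀ * ((L : ℝ) ^ K) ^ (-(γ / 2)) * Real.exp (-(δ * tdistT M y y')))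
      ∧ (∀ μ, HasMaj (BlockNorm.ofBlocks (unitTorusGeoS L K M Msz) (liftBlk (blockOf (L ^ K) M) ι))
          (BlockNorm.ofBlocks (unitTorusGeoS L K M Msz) (liftBlk (blockOf (L ^ K) M ∘ underPtN L K n M) ι))
          (idef (pull (liftMap (underPtN L K n M) ι)) (pull (liftMap (underPtN L K n M) ι)) (tensorId ι (kingDOp L a 0 (K + n) (L ^ n * L ^ K) M μ)) (tensorId ι (kingDOp L a 0 K (L ^ K) M μ)))
          (fun y y' => m₀ * ((L : ℝ) ^ K) ^ (-(γ / 2)) * Real.exp (-(δ * tdistT M y y')))) := by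
  obtain ⟨β, δ, m₀, hβ, hδ, hm₀, HU⟩ := kingScalarLayer_massless_letters (d := d) L hLodd hL ha hγ0 hγ1
  refine ⟨β, δ, m₀, hβ, hδ, hm₀, fun K hK n hn e M _ hM Msz => ?_⟩
  obtain ⟨hG, hD, hG', hD', hDG, hDD⟩ := HU K hK n hn e M hM Msz
  have hθ : 0 ≤ ((L : ℝ) ^ K) ^ (-(γ / 2)) := Real.rpow_nonneg (pow_nonneg (Nat.cast_nonneg _) _) _
  have hβe : ∀ y y' : (unitTorusGeoS L K M Msz).Site, 0 ≤ β * Real.exp (-(δ * tdistT M y y')) := fun _ _ => mul_nonneg hβ.le (Real.exp_nonneg _)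
  have hme : ∀ y y' : (unitTorusGeoS L K M Msz).Site, 0 ≤ m₀ * ((L : ℝ) ^ K) ^ (-(γ / 2)) * Real.exp (-(δ * tdistT M y y')) :=
    fun _ _ => mul_nonneg (mul_nonneg hm₀.le hθ) (Real.exp_nonneg _)
  refine ⟨hasMaj_tensorId ι hβe hG, fun μ => hasMaj_tensorId ι hβe (hD μ), hasMaj_tensorId ι hβe hG', fun μ => hasMaj_tensorId ι hβe (hD' μ), ?_, fun μ => ?_⟩
  · rw [idef_tensorId]; exact hasMaj_tensorId ι hme hDG
  · rw [idef_tensorId]; exact hasMaj_tensorId ι hme (hDD μ)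

end Lifted

/-! ## §2 ★★★ The coloured socket's sized letters from a matrix species' three diagonal letters read at size -/

section LettersM

variable (ι : Type) [Fintype ι] [DecidableEq ι] (Mn : I → Fin (d + 1) → ℕ) [hMn0 : ∀ i μ, NeZero (Mn i μ)] (kk mm : I → ℕ) (Msz : I → ℝ) (Bc Bf : I → B9.Backgrounds)
  (avg : ∀ i, (Bf i).Cfg → (Bc i).Cfg)
  (Vc : ∀ i, (Bc i).Cfg → (((Tor (fine (L ^ kk i) (Mn i)) × ι) × Option (Fin (d + 1)) → ℝ) →ₗ[ℝ] (Tor (fine (L ^ kk i) (Mn i)) × ι → ℝ)))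
  (Vf : ∀ i, (Bf i).Cfg → (((Tor (fine (L ^ mm i * L ^ kk i) (Mn i)) × ι) × Option (Fin (d + 1)) → ℝ) →ₗ[ℝ] (Tor (fine (L ^ mm i * L ^ kk i) (Mn i)) × ι → ℝ)))

set_option maxHeartbeats 400000 in
/-- ★★★ **THE COLOURED SOCKET's SIZED LETTERS FROM A MATRIX SPECIES' THREE DIAGONAL LETTERS READ AT SIZE** — part XI §2 on the coloured carriers: smallness `s = M_sz i·α₀`; HYPOTHESIS `hV`:
`V̂c i (avg U) ≤ diagK (K s)` in n15-b's matrix frames `blkPair (liftBlk blockOf ι) → liftBlk blockOf ι`, `V̂f i U ≤ diagK (K s)` on `liftBlk (blockOf ∘ pr) ι`, the fit `𝔇(V̂f i U, V̂c i (avg U))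
≤ diagK (K s (L^{k i})^{−γ∕2})` through `(pull (liftPair (liftMap pr ι)), pull (liftMap pr ι))`, for `s ≤ a₁`, `U` `(3.35)`-regular at level `c₃₅`; CONCLUSION = part XXI's sized `hP` for
`Pf∕Pc := siteEntriesC (sitePertC (liftMap blockOf ι) (G′ ⊗ 1) (dressedOp (G′ ⊗ 1) (D ⊗ 1) V̂))`, `G′` THE massless scalar site propagator of the run, rate exponent `γ∕2`; odd `L ≥ 3`, `a_S > 0`,
`0 < γ < 1`, `k i, m i ≥ 1`, `M_sz i ≥ 1`. [cite: Balaban1985BackgroundPropagators, (3.52) p.400 + (3.63)–(3.67) pp.402–403 (mechanism, colour-mixing first order), (3.35) p.396 (the letters at size); King1986, Prop. 3.8 (3.71) p.664] -/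
theorem siteLettersC_of_sizedSpeciesLettersM (hLodd : Odd L) (hL2 : 2 ≤ L) {aS : ℝ} (haS : 0 < aS) (c35 : ℝ) {γ : ℝ} (hγ0 : 0 < γ) (hγ1 : γ < 1)
    {mT : I → ℕ} (hMnT : ∀ i μ, Mn i μ = 2 * L ^ mT i) (hk : ∀ i, 1 ≤ kk i) (hm : ∀ i, 1 ≤ mm i)
    (hMsz : ∀ i, 1 ≤ Msz i)
    (hV : ∃ K a₁ : ℝ, 0 ≤ K ∧ 0 < a₁ ∧ ∀ (i : I) (α₀ : ℝ), 0 < α₀ → Msz i * α₀ ≤ a₁ → ∀ U : (Bf i).Cfg, (Bf i).Reg335 c35 α₀ U →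
      HasMaj (BlockNorm.ofBlocks (unitTorusGeoS L (kk i) (Mn i) (Msz i)) (blkPair (liftBlk (blockOf (L ^ kk i) (Mn i)) ι)))
        (BlockNorm.ofBlocks (unitTorusGeoS L (kk i) (Mn i) (Msz i)) (liftBlk (blockOf (L ^ kk i) (Mn i)) ι)) (Vc i (avg i U)) (diagK fun _ => K * (Msz i * α₀)) ∧
      HasMaj (BlockNorm.ofBlocks (unitTorusGeoS L (kk i) (Mn i) (Msz i)) (blkPair (liftBlk (blockOf (L ^ kk i) (Mn i) ∘ underPtN L (kk i) (mm i) (Mn i)) ι)))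
        (BlockNorm.ofBlocks (unitTorusGeoS L (kk i) (Mn i) (Msz i)) (liftBlk (blockOf (L ^ kk i) (Mn i) ∘ underPtN L (kk i) (mm i) (Mn i)) ι)) (Vf i U)
        (diagK fun _ => K * (Msz i * α₀)) ∧
      HasMaj (BlockNorm.ofBlocks (unitTorusGeoS L (kk i) (Mn i) (Msz i)) (blkPair (liftBlk (blockOf (L ^ kk i) (Mn i)) ι)))
        (BlockNorm.ofBlocks (unitTorusGeoS L (kk i) (Mn i) (Msz i)) (liftBlk (blockOf (L ^ kk i) (Mn i) ∘ underPtN L (kk i) (mm i) (Mn i)) ι))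
        (idef (pull (liftPair (liftMap (underPtN L (kk i) (mm i) (Mn i)) ι))) (pull (liftMap (underPtN L (kk i) (mm i) (Mn i)) ι)) (Vf i U) (Vc i (avg i U)))
        (diagK fun _ => K * (Msz i * α₀) * ((L : ℝ) ^ kk i) ^ (-(γ / 2)))) :
    ∃ δP ζ τ a₁ : ℝ, 0 < δP ∧ 0 < ζ ∧ 0 < τ ∧ 0 < a₁ ∧
      ∀ (i : I) (α₀ : ℝ), 0 < α₀ → Msz i * α₀ ≤ a₁ → ∀ U : (Bf i).Cfg, (Bf i).Reg335 c35 α₀ U →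
        (∀ p p' : Idx (Mn i) × ι, |siteEntriesC (Mn i) ι (sitePertC (Mn i) ι (liftMap (blockOf (L ^ kk i) (Mn i)) ι) (tensorId ι (kingGOp L aS 0 (kk i) (L ^ kk i) (Mn i)))
            (dressedOp (tensorId ι (kingGOp L aS 0 (kk i) (L ^ kk i) (Mn i))) (fun μ => tensorId ι (kingDOp L aS 0 (kk i) (L ^ kk i) (Mn i) μ)) (Vc i (avg i U)))) p p'|
            ≤ ζ * (Msz i * α₀) * Real.exp (-(δP * tdist (Mn i) p.1 p'.1))) ∧
        (∀ p p' : Idx (Mn i) × ι, |siteEntriesC (Mn i) ι (sitePertC (Mn i) ι (liftMap (blockOf (L ^ kk i) (Mn i) ∘ underPtN L (kk i) (mm i) (Mn i)) ι)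
            (tensorId ι (kingGOp L aS 0 (kk i + mm i) (L ^ mm i * L ^ kk i) (Mn i)))
            (dressedOp (tensorId ι (kingGOp L aS 0 (kk i + mm i) (L ^ mm i * L ^ kk i) (Mn i))) (fun μ => tensorId ι (kingDOp L aS 0 (kk i + mm i) (L ^ mm i * L ^ kk i) (Mn i) μ))
              (Vf i U))) p p'|
            ≤ ζ * (Msz i * α₀) * Real.exp (-(δP * tdist (Mn i) p.1 p'.1))) ∧
        (∀ p p' : Idx (Mn i) × ι, |siteEntriesC (Mn i) ι (sitePertC (Mn i) ι (liftMap (blockOf (L ^ kk i) (Mn i) ∘ underPtN L (kk i) (mm i) (Mn i)) ι)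
              (tensorId ι (kingGOp L aS 0 (kk i + mm i) (L ^ mm i * L ^ kk i) (Mn i)))
              (dressedOp (tensorId ι (kingGOp L aS 0 (kk i + mm i) (L ^ mm i * L ^ kk i) (Mn i))) (fun μ => tensorId ι (kingDOp L aS 0 (kk i + mm i) (L ^ mm i * L ^ kk i) (Mn i) μ))
                (Vf i U))) p p'
            - siteEntriesC (Mn i) ι (sitePertC (Mn i) ι (liftMap (blockOf (L ^ kk i) (Mn i)) ι) (tensorId ι (kingGOp L aS 0 (kk i) (L ^ kk i) (Mn i)))
              (dressedOp (tensorId ι (kingGOp L aS 0 (kk i) (L ^ kk i) (Mn i))) (fun μ => tensorId ι (kingDOp L aS 0 (kk i) (L ^ kk i) (Mn i) μ)) (Vc i (avg i U)))) p p'|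
            ≤ τ * ((L : ℝ) ^ kk i) ^ (-(γ / 2)) * Real.exp (-(δP * tdist (Mn i) p.1 p'.1))) := by
  obtain ⟨β, δ, m₀, hβ, hδ, hm₀, HU⟩ := tensorId_massless_letters (d := d) ι hLodd hL2 haS hγ0.le hγ1
  obtain ⟨K, a₁, hK, ha₁, HV⟩ := hV
  have hLr : (0 : ℝ) ≤ (L : ℝ) := Nat.cast_nonneg _
  -- the Combes–Thomas row sum at `σ = δ∕2`, the threshold on `s = M_sz·α₀`
  set cr : ℝ := latticeConst (d + 1) (δ / 2) with hcr_def
  have hcr : 0 ≤ cr := latticeConst_nonneg _ (by positivity)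
  set a₁' : ℝ := min a₁ (1 / (2 * β * K * cr + 1)) with ha₁'_def
  have hden : 0 < 2 * β * K * cr + 1 := by positivity
  have ha₁' : 0 < a₁' := lt_min ha₁ (by positivity)
  have ha₁'a₁ : a₁' ≤ a₁ := min_le_left _ _
  have hguard : β * (K * a₁') * cr ≤ 1 / 2 := by
    have h1 : a₁' ≤ 1 / (2 * β * K * cr + 1) := min_le_right _ _
    have h2 : β * K * cr * a₁' ≤ β * K * cr * (1 / (2 * β * K * cr + 1)) := mul_le_mul_of_nonneg_left h1 (by positivity)
    have h3 : β * K * cr * (1 / (2 * β * K * cr + 1)) ≤ 1 / 2 := by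
      rw [mul_one_div, div_le_iff₀ hden]; nlinarith [mul_nonneg (mul_nonneg hβ.le hK) hcr]
    nlinarith
  obtain ⟨B, hBdef⟩ : ∃ B : ℝ, B = 2 * β := ⟨_, rfl⟩
  obtain ⟨ε, hεdef⟩ : ∃ ε : ℝ, ε = 2 * β ^ 2 * K * cr + 1 := ⟨_, rfl⟩
  obtain ⟨mX, hmXdef⟩ : ∃ mX : ℝ, mX = bgConst β cr m₀ K a₁' := ⟨_, rfl⟩
  have hB0 : 0 ≤ B := by rw [hBdef]; positivity
  have hε0 : 0 < ε := by rw [hεdef]; positivity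
  have hmX0 : 0 ≤ mX := by rw [hmXdef]; exact bgConst_nonneg hβ.le hcr hm₀.le hK ha₁'.le
  -- part XXII §3 at the dressed coloured letters (stated at rate `δ∕2`)
  refine siteLettersC_of_sizedDressedLetters (L := L) ι Mn kk Msz (fun i => Tor (fine (L ^ kk i) (Mn i)) × ι) (fun i => Tor (fine (L ^ mm i * L ^ kk i) (Mn i)) × ι)
    (fun i => liftMap (blockOf (L ^ kk i) (Mn i)) ι) (fun i => liftMap (underPtN L (kk i) (mm i) (Mn i)) ι) Bc Bf avg
    (fun i => tensorId ι (kingGOp L aS 0 (kk i) (L ^ kk i) (Mn i))) (fun i => tensorId ι (kingGOp L aS 0 (kk i + mm i) (L ^ mm i * L ^ kk i) (Mn i)))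
    (fun i V => dressedOp (tensorId ι (kingGOp L aS 0 (kk i) (L ^ kk i) (Mn i))) (fun μ => tensorId ι (kingDOp L aS 0 (kk i) (L ^ kk i) (Mn i) μ)) (Vc i V))
    (fun i U => dressedOp (tensorId ι (kingGOp L aS 0 (kk i + mm i) (L ^ mm i * L ^ kk i) (Mn i))) (fun μ => tensorId ι (kingDOp L aS 0 (kk i + mm i) (L ^ mm i * L ^ kk i) (Mn i) μ))
      (Vf i U))
    c35 (γP := γ / 2) (fun i => zero_le_one.trans (hMsz i)) (fun i => ?_)
    ⟨β, B, ε * 1, mX, m₀, δ / 2, a₁', hβ.le, hB0, by positivity, hmX0, hm₀.le, half_pos hδ, ha₁', fun i => ?_⟩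
  · -- uniform fibres of the colour-lifted pairing
    obtain ⟨N, hN, hfib⟩ := card_fibre_underPtN_ne (L := L) (kk i) (mm i) (Mn i)
    refine ⟨N, hN, fun x => ?_⟩
    rw [← hfib x.1]
    refine Finset.card_bij (fun p _ => p.1) (fun p hp => ?_) (fun p₁ hp₁ p₂ hp₂ h => ?_) (fun x' hx' => ?_)
    · have hp' := (Literature.MathematicalPhysics.QuantumFieldTheory.Balaban1983to89.T4EtaRateCoeffDefect.mem_fibre _ _ _).1 hp
      exact (Literature.MathematicalPhysics.QuantumFieldTheory.Balaban1983to89.T4EtaRateCoeffDefect.mem_fibre _ _ _).2 (congrArg Prod.fst hp')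
    · have h1 := (Literature.MathematicalPhysics.QuantumFieldTheory.Balaban1983to89.T4EtaRateCoeffDefect.mem_fibre _ _ _).1 hp₁
      have h2 := (Literature.MathematicalPhysics.QuantumFieldTheory.Balaban1983to89.T4EtaRateCoeffDefect.mem_fibre _ _ _).1 hp₂
      have e1 : p₁.2 = x.2 := congrArg Prod.snd h1
      have e2 : p₂.2 = x.2 := congrArg Prod.snd h2
      exact Prod.ext h (e1.trans e2.symm)
    · refine ⟨(x', x.2), (Literature.MathematicalPhysics.QuantumFieldTheory.Balaban1983to89.T4EtaRateCoeffDefect.mem_fibre _ _ _).2 ?_, rfl⟩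
      have hx'' := (Literature.MathematicalPhysics.QuantumFieldTheory.Balaban1983to89.T4EtaRateCoeffDefect.mem_fibre _ _ _).1 hx'
      exact Prod.ext hx'' rfl
  obtain ⟨hG, hD, hG', hD', hDG, hDD⟩ := HU (kk i) (hk i) (mm i) (hm i) (mT i) (Mn i) (hMnT i) (Msz i)
  -- carrier facts
  have htri := triangle254_unitTorusGeo L (kk i) (Mn i)
  have hrow := rowSum_unitTorusGeo L (kk i) (Mn i) (half_pos hδ)
  have hd : ∀ a b : (unitTorusGeoS L (kk i) (Mn i) (Msz i)).Site, 0 ≤ (unitTorusGeoS L (kk i) (Mn i) (Msz i)).dist a b := fun a b => tdistT_nonneg (Mn i) a b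
  have hθ : 0 ≤ ((L : ℝ) ^ kk i) ^ (-(γ / 2)) := Real.rpow_nonneg (pow_nonneg hLr _) _
  -- the letters at rate `δ∕2`
  have wk : ∀ {C : ℝ}, 0 ≤ C → ∀ y y' : Tor (Mn i), C * Real.exp (-(δ * tdistT (Mn i) y y')) ≤ C * Real.exp (-(δ / 2 * (unitTorusGeoS L (kk i) (Mn i) (Msz i)).dist y y')) :=
    fun hC y y' => mul_le_mul_of_nonneg_left (Real.exp_le_exp.mpr (neg_le_neg (by
      rw [unitTorusGeoS_dist]; nlinarith [tdistT_nonneg (Mn i) y y', hδ]))) hC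
  have hGc2 := hG.mono (wk hβ.le)
  have hGf2 := hG'.mono (wk hβ.le)
  have hDG2 := hDG.mono (wk (mul_nonneg hm₀.le hθ))
  refine ⟨hGc2, hGf2, hDG2, fun α₀ hα₀ hsa U hreg => ?_⟩
  -- the smallness parameter of the index `s = M_sz i·α₀`
  have hs0 : 0 < Msz i * α₀ := mul_pos (lt_of_lt_of_le one_pos (hMsz i)) hα₀
  have hsa₁ : Msz i * α₀ ≤ a₁ := hsa.trans ha₁'a₁
  obtain ⟨hVc, hVf, hDV⟩ := HV i α₀ hα₀ hsa₁ U hreg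
  have hR : 0 ≤ K * (Msz i * α₀) := mul_nonneg hK hs0.le
  have hq : β * (K * (Msz i * α₀)) * cr ≤ 1 / 2 := (mul_le_mul_of_nonneg_right (mul_le_mul_of_nonneg_left (mul_le_mul_of_nonneg_left hsa hK) hβ.le) hcr).trans hguard
  have hq1 : β * (K * (Msz i * α₀)) * cr < 1 := by linarith
  have hinv : (1 - β * (K * (Msz i * α₀)) * cr)⁻¹ ≤ 2 := inv_one_sub_le_two hq
  have hinv0 : 0 ≤ (1 - β * (K * (Msz i * α₀)) * cr)⁻¹ := inv_nonneg.2 (by linarith)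
  have hρδ : δ / 2 + δ / 2 ≤ δ := by linarith
  -- S4's three dressing theorems on the coloured block maps `liftBlk blockOf ι`, coarse and fine
  have hXc := hasMaj_dressedOp (g := unitTorusGeoS L (kk i) (Mn i) (Msz i)) (liftBlk (blockOf (L ^ kk i) (Mn i)) ι) htri hd hrow (by positivity) (by positivity : (0 : ℝ) ≤ δ / 2)
    hρδ hβ.le hR hG hD hVc hq1
  have hXf := hasMaj_dressedOp (g := unitTorusGeoS L (kk i) (Mn i) (Msz i)) (liftBlk (blockOf (L ^ kk i) (Mn i) ∘ underPtN L (kk i) (mm i) (Mn i)) ι) htri hd hrow (by positivity)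
    (by positivity : (0 : ℝ) ≤ δ / 2) hρδ hβ.le hR hG' hD' hVf hq1
  have hEc := hasMaj_dressedOp_sub (g := unitTorusGeoS L (kk i) (Mn i) (Msz i)) (liftBlk (blockOf (L ^ kk i) (Mn i)) ι) htri hd hrow (by positivity) (by positivity : (0 : ℝ) ≤ δ / 2)
    hρδ hβ.le hR hG hD hVc hq1
  have hEf := hasMaj_dressedOp_sub (g := unitTorusGeoS L (kk i) (Mn i) (Msz i)) (liftBlk (blockOf (L ^ kk i) (Mn i) ∘ underPtN L (kk i) (mm i) (Mn i)) ι) htri hd hrow (by positivity)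
    (by positivity : (0 : ℝ) ≤ δ / 2) hρδ hβ.le hR hG' hD' hVf hq1
  have hDX := hasMaj_idef_dressedOp (g := unitTorusGeoS L (kk i) (Mn i) (Msz i)) (liftBlk (blockOf (L ^ kk i) (Mn i)) ι) (liftMap (underPtN L (kk i) (mm i) (Mn i)) ι) htri hd hrow
    (by positivity) hcr (K := K) (a₀ := Msz i * α₀) (by linarith : δ / 2 ≤ δ) hβ.le hm₀.le hθ hq hR le_rfl hG hD hG' hD' hDG hDD hVc hVf hDV
  have hXc2 : HasMaj (BlockNorm.ofBlocks (unitTorusGeoS L (kk i) (Mn i) (Msz i)) (liftBlk (blockOf (L ^ kk i) (Mn i)) ι))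
      (BlockNorm.ofBlocks (unitTorusGeoS L (kk i) (Mn i) (Msz i)) (liftBlk (blockOf (L ^ kk i) (Mn i)) ι))
      (dressedOp (tensorId ι (kingGOp L aS 0 (kk i) (L ^ kk i) (Mn i))) (fun μ => tensorId ι (kingDOp L aS 0 (kk i) (L ^ kk i) (Mn i) μ)) (Vc i (avg i U)))
      (fun y y' => B * Real.exp (-(δ / 2 * (unitTorusGeoS L (kk i) (Mn i) (Msz i)).dist y y'))) :=
    hXc.mono fun y y' => mul_le_mul_of_nonneg_right (by nlinarith [mul_le_mul_of_nonneg_left hinv hβ.le]) (Real.exp_nonneg _)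
  have hXf2 : HasMaj (BlockNorm.ofBlocks (unitTorusGeoS L (kk i) (Mn i) (Msz i)) (liftBlk (blockOf (L ^ kk i) (Mn i) ∘ underPtN L (kk i) (mm i) (Mn i)) ι))
      (BlockNorm.ofBlocks (unitTorusGeoS L (kk i) (Mn i) (Msz i)) (liftBlk (blockOf (L ^ kk i) (Mn i) ∘ underPtN L (kk i) (mm i) (Mn i)) ι))
      (dressedOp (tensorId ι (kingGOp L aS 0 (kk i + mm i) (L ^ mm i * L ^ kk i) (Mn i))) (fun μ => tensorId ι (kingDOp L aS 0 (kk i + mm i) (L ^ mm i * L ^ kk i) (Mn i) μ)) (Vf i U))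
      (fun y y' => B * Real.exp (-(δ / 2 * (unitTorusGeoS L (kk i) (Mn i) (Msz i)).dist y y'))) :=
    hXf.mono fun y y' => mul_le_mul_of_nonneg_right (by nlinarith [mul_le_mul_of_nonneg_left hinv hβ.le]) (Real.exp_nonneg _)
  have hamp : β * (K * (Msz i * α₀) * (β * (1 - β * (K * (Msz i * α₀)) * cr)⁻¹)) * cr ≤ ε * 1 * (Msz i * α₀) := by
    have h1 : β * (K * (Msz i * α₀) * (β * (1 - β * (K * (Msz i * α₀)) * cr)⁻¹)) * cr = (β * β * K * cr * (1 - β * (K * (Msz i * α₀)) * cr)⁻¹) * (Msz i * α₀) := by ring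
    rw [h1, mul_one]
    refine mul_le_mul_of_nonneg_right ?_ hs0.le
    rw [hεdef]
    nlinarith [mul_le_mul_of_nonneg_left hinv (show 0 ≤ β * β * K * cr by positivity)]
  have hEc2 : HasMaj (BlockNorm.ofBlocks (unitTorusGeoS L (kk i) (Mn i) (Msz i)) (liftBlk (blockOf (L ^ kk i) (Mn i)) ι))
      (BlockNorm.ofBlocks (unitTorusGeoS L (kk i) (Mn i) (Msz i)) (liftBlk (blockOf (L ^ kk i) (Mn i)) ι))
      (dressedOp (tensorId ι (kingGOp L aS 0 (kk i) (L ^ kk i) (Mn i))) (fun μ => tensorId ι (kingDOp L aS 0 (kk i) (L ^ kk i) (Mn i) μ)) (Vc i (avg i U))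
        - tensorId ι (kingGOp L aS 0 (kk i) (L ^ kk i) (Mn i)))
      (fun y y' => ε * 1 * (Msz i * α₀) * Real.exp (-(δ / 2 * (unitTorusGeoS L (kk i) (Mn i) (Msz i)).dist y y'))) :=
    hEc.mono fun y y' => mul_le_mul_of_nonneg_right hamp (Real.exp_nonneg _)
  have hEf2 : HasMaj (BlockNorm.ofBlocks (unitTorusGeoS L (kk i) (Mn i) (Msz i)) (liftBlk (blockOf (L ^ kk i) (Mn i) ∘ underPtN L (kk i) (mm i) (Mn i)) ι))
      (BlockNorm.ofBlocks (unitTorusGeoS L (kk i) (Mn i) (Msz i)) (liftBlk (blockOf (L ^ kk i) (Mn i) ∘ underPtN L (kk i) (mm i) (Mn i)) ι))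
      (dressedOp (tensorId ι (kingGOp L aS 0 (kk i + mm i) (L ^ mm i * L ^ kk i) (Mn i))) (fun μ => tensorId ι (kingDOp L aS 0 (kk i + mm i) (L ^ mm i * L ^ kk i) (Mn i) μ)) (Vf i U)
        - tensorId ι (kingGOp L aS 0 (kk i + mm i) (L ^ mm i * L ^ kk i) (Mn i)))
      (fun y y' => ε * 1 * (Msz i * α₀) * Real.exp (-(δ / 2 * (unitTorusGeoS L (kk i) (Mn i) (Msz i)).dist y y'))) :=
    hEf.mono fun y y' => mul_le_mul_of_nonneg_right hamp (Real.exp_nonneg _)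
  have hDX2 : HasMaj (BlockNorm.ofBlocks (unitTorusGeoS L (kk i) (Mn i) (Msz i)) (liftBlk (blockOf (L ^ kk i) (Mn i)) ι))
      (BlockNorm.ofBlocks (unitTorusGeoS L (kk i) (Mn i) (Msz i)) (liftBlk (blockOf (L ^ kk i) (Mn i) ∘ underPtN L (kk i) (mm i) (Mn i)) ι))
      (idef (pull (liftMap (underPtN L (kk i) (mm i) (Mn i)) ι)) (pull (liftMap (underPtN L (kk i) (mm i) (Mn i)) ι))
        (dressedOp (tensorId ι (kingGOp L aS 0 (kk i + mm i) (L ^ mm i * L ^ kk i) (Mn i))) (fun μ => tensorId ι (kingDOp L aS 0 (kk i + mm i) (L ^ mm i * L ^ kk i) (Mn i) μ)) (Vf i U))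
        (dressedOp (tensorId ι (kingGOp L aS 0 (kk i) (L ^ kk i) (Mn i))) (fun μ => tensorId ι (kingDOp L aS 0 (kk i) (L ^ kk i) (Mn i) μ)) (Vc i (avg i U))))
      (fun y y' => mX * ((L : ℝ) ^ kk i) ^ (-(γ / 2)) * Real.exp (-(δ / 2 * (unitTorusGeoS L (kk i) (Mn i) (Msz i)).dist y y'))) := by
    refine hDX.mono fun y y' => ?_
    have hsub : δ - δ / 2 = δ / 2 := by ring
    rw [hsub]
    exact mul_le_mul_of_nonneg_right (mul_le_mul_of_nonneg_right ((bgConst_mono_a₀ hβ.le hcr hm₀.le hK hsa).trans_eq hmXdef.symm) hθ) (Real.exp_nonneg _)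
  exact ⟨hXc2, hXf2, hEc2, hEf2, hDX2⟩

end LettersM

/-! ## §3 ★★★ `NE2PlusSite` for every colour entry over the sized carriers from the matrix species' sized letters alone -/

section SocketM

variable (ι : Type) [Fintype ι] [DecidableEq ι] (Mn : I → Fin (d + 1) → ℕ) [hMn0 : ∀ i μ, NeZero (Mn i μ)] (kk mm : I → ℕ) (Msz : I → ℝ) (X : I → Type) [∀ i, Fintype (X i)]
  (blk : ∀ i, X i → Tor (Mn i)) (gf : I → B9.Geometry) (Bc Bf : I → B9.Backgrounds)
  (Vc : ∀ i, (Bc i).Cfg → (((Tor (fine (L ^ kk i) (Mn i)) × ι) × Option (Fin (d + 1)) → ℝ) →ₗ[ℝ] (Tor (fine (L ^ kk i) (Mn i)) × ι → ℝ)))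
  (Vf : ∀ i, (Bf i).Cfg → (((Tor (fine (L ^ mm i * L ^ kk i) (Mn i)) × ι) × Option (Fin (d + 1)) → ℝ) →ₗ[ℝ] (Tor (fine (L ^ mm i * L ^ kk i) (Mn i)) × ι → ℝ)))

/-- ★★★ **`NE2PlusSite`, EVERY COLOUR ENTRY, WITH THE BACKGROUND LIVE THROUGH A COLOUR-MIXING SPECIES, ON SIZE-LIVE CARRIERS, FROM THE SPECIES' SIZED LETTERS ALONE** — part XXI's
coloured socket ∘ §2 on a family `pi i = ⟨opGeo (unitTorusGeoS L (k i) (M i) (M_sz i)) (X i) (blk i), gf i, Bc i, Bf i, pair i⟩` (`gf.M = M_sz i` by the pairing's `M_eq`, `M_sz i ≥ 1`):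
the colour entries `(c i, c′ i)` of the DRESSED coloured site kernels `((Q′G′²Q′* ⊗ 1)_{L^mL^k} + P_f(U))⁻¹ − ((Q′G′²Q′* ⊗ 1)_{L^k} + P_c(Ū))⁻¹` with `P = siteEntriesC (sitePertC … (G′ ⊗ 1)
(dressedOp (G′ ⊗ 1) (D ⊗ 1) V̂))` satisfy `NE2PlusSite d′ p c₃₅` — the printed smallness `M·α₀ ≤ a₀` live. [cite: Balaban1985BackgroundPropagators, Thm 3.2 (3.48) p.398 + Thm 3.14 pp.426–427 (quantifier template), (3.52) p.400, (3.63)–(3.67) pp.402–403 (mechanism); Balaban1984PropagatorsI, (1.45) p.26; King1986, Prop. 3.8 (3.71) p.664; CombesThomas1973, §II] -/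
theorem ne2PlusSite_cSiteExOn_of_sizedSpeciesLettersM (hLodd : Odd L) (hL2 : 2 ≤ L) {aS : ℝ} (haS : 0 < aS) (c35 : ℝ) (d' : ℕ) (p : ℝ) {γ : ℝ} (hγ0 : 0 < γ) (hγ1 : γ < 1)
    {mT : I → ℕ} (hMnT : ∀ i μ, Mn i μ = 2 * L ^ mT i) (hk : ∀ i, 1 ≤ kk i) (hm : ∀ i, 1 ≤ mm i) (hMsz : ∀ i, 1 ≤ Msz i)
    (pair : ∀ i, EtaPairing (opGeo (unitTorusGeoS L (kk i) (Mn i) (Msz i)) (X i) (blk i)) (gf i) (Bc i) (Bf i))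
    (hV : ∃ K a₁ : ℝ, 0 ≤ K ∧ 0 < a₁ ∧ ∀ (i : I) (α₀ : ℝ), 0 < α₀ → Msz i * α₀ ≤ a₁ → ∀ U : (Bf i).Cfg, (Bf i).Reg335 c35 α₀ U →
      HasMaj (BlockNorm.ofBlocks (unitTorusGeoS L (kk i) (Mn i) (Msz i)) (blkPair (liftBlk (blockOf (L ^ kk i) (Mn i)) ι)))
        (BlockNorm.ofBlocks (unitTorusGeoS L (kk i) (Mn i) (Msz i)) (liftBlk (blockOf (L ^ kk i) (Mn i)) ι)) (Vc i ((pair i).avg U)) (diagK fun _ => K * (Msz i * α₀)) ∧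
      HasMaj (BlockNorm.ofBlocks (unitTorusGeoS L (kk i) (Mn i) (Msz i)) (blkPair (liftBlk (blockOf (L ^ kk i) (Mn i) ∘ underPtN L (kk i) (mm i) (Mn i)) ι)))
        (BlockNorm.ofBlocks (unitTorusGeoS L (kk i) (Mn i) (Msz i)) (liftBlk (blockOf (L ^ kk i) (Mn i) ∘ underPtN L (kk i) (mm i) (Mn i)) ι)) (Vf i U)
        (diagK fun _ => K * (Msz i * α₀)) ∧
      HasMaj (BlockNorm.ofBlocks (unitTorusGeoS L (kk i) (Mn i) (Msz i)) (blkPair (liftBlk (blockOf (L ^ kk i) (Mn i)) ι)))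
        (BlockNorm.ofBlocks (unitTorusGeoS L (kk i) (Mn i) (Msz i)) (liftBlk (blockOf (L ^ kk i) (Mn i) ∘ underPtN L (kk i) (mm i) (Mn i)) ι))
        (idef (pull (liftPair (liftMap (underPtN L (kk i) (mm i) (Mn i)) ι))) (pull (liftMap (underPtN L (kk i) (mm i) (Mn i)) ι)) (Vf i U) (Vc i ((pair i).avg U)))
        (diagK fun _ => K * (Msz i * α₀) * ((L : ℝ) ^ kk i) ^ (-(γ / 2))))
    (c c' : I → ι) :
    NE2PlusSite d' p c35 (fun i => (⟨opGeo (unitTorusGeoS L (kk i) (Mn i) (Msz i)) (X i) (blk i), gf i, Bc i, Bf i, pair i⟩ : PairedInstance))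
      (cSiteExOn ι Mn kk mm Msz X blk gf Bc Bf aS pair
        (fun i U => siteEntriesC (Mn i) ι (sitePertC (Mn i) ι (liftMap (blockOf (L ^ kk i) (Mn i) ∘ underPtN L (kk i) (mm i) (Mn i)) ι)
          (tensorId ι (kingGOp L aS 0 (kk i + mm i) (L ^ mm i * L ^ kk i) (Mn i)))
          (dressedOp (tensorId ι (kingGOp L aS 0 (kk i + mm i) (L ^ mm i * L ^ kk i) (Mn i))) (fun μ => tensorId ι (kingDOp L aS 0 (kk i + mm i) (L ^ mm i * L ^ kk i) (Mn i) μ))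
            (Vf i U))))
        (fun i V => siteEntriesC (Mn i) ι (sitePertC (Mn i) ι (liftMap (blockOf (L ^ kk i) (Mn i)) ι) (tensorId ι (kingGOp L aS 0 (kk i) (L ^ kk i) (Mn i)))
          (dressedOp (tensorId ι (kingGOp L aS 0 (kk i) (L ^ kk i) (Mn i))) (fun μ => tensorId ι (kingDOp L aS 0 (kk i) (L ^ kk i) (Mn i) μ)) (Vc i V))))
        c c') := by
  have hgM : ∀ i, (gf i).M = Msz i := fun i => (pair i).M_eq
  have hM : ∀ i, 1 ≤ (gf i).M := fun i => (hgM i).symm ▸ hMsz i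
  obtain ⟨δP, ζ, τ, a₁, hδP, hζ, hτ, ha₁, HP⟩ :=
    siteLettersC_of_sizedSpeciesLettersM (L := L) ι Mn kk mm Msz Bc Bf (fun i => (pair i).avg) Vc Vf hLodd hL2 haS c35 hγ0 hγ1 hMnT hk hm hMsz hV
  refine ne2PlusSite_cSiteExOn_of_sizedLetters ι Mn kk mm Msz X blk gf Bc Bf hLodd hL2 haS c35 d' p hMnT hk hM pair _ _ (half_pos hγ0)
    ⟨δP, ζ, τ, a₁, hδP, hζ, hτ, ha₁, fun i α₀ hα₀ hMα U hreg => ?_⟩ c c'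
  rw [hgM i] at hMα ⊢
  exact HP i α₀ hα₀ hMα U hreg

end SocketM

end Summit.QuantumFields.YangMills.BalabanUVNodes.N15.SiteLayerBg

end
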